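import Literature.AnabelianGeometry.AbsoluteAnabelian.MonoidKummerMaps
import Literature.AnabelianGeometry.AbsoluteAnabelian.AbsTopIII.KummerFaithfulLocalFieldProofs
import HarnessLib

/-!
# [AbsTopIII] Prop 3.3 (ii), determination half: an isomorphism of MLF-Galois `TLG`/`TCG`-pairs is
# determined by its Galois component and its action on the cyclotome

Proof-only companion (theorems only, no new definitions) of `MonoidKummerMaps.lean` (seat
abc-iut-L4-t2; S. Mochizuki, *Topics in Absolute Anabelian Geometry III*, Prop. 3.3 (ii) p. 74,
kurims manuscript, lit key `paper:url-5493eb38cbb7`): "the functoriality of the Kummer classes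
[...] an isomorphism `(Π ↷ M) ⥲ (Π* ↷ M*)` induces `Π ⥲ Π*`, `μ_Ẑ(M) ⥲ μ_Ẑ(M*)`, which determine
an injection `Isom((Π ↷ M),(Π* ↷ M*)) ↪ Isom(Π,Π*) × Isom(μ_Ẑ(M), μ_Ẑ(M*))`".

`UnitPairIsoFibres` (the named fact, typed by abc-iut-L4-t2) is the conjunction of this
DETERMINATION statement (for `T ∈ {TLG, TCG}`) and the SURJECTIVITY / fibre-cardinality statement
for `TLG`.  This file PROVES the first conjunct — `unitPairIso_isoM_eq` — by the Kummer-class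
argument of the text: reduce to a `Gal(k̄/k)`-equivariant multiplicative automorphism `β` of the
model object `k̄^×` (resp. `𝒪_k̄^×`) acting trivially on the cyclotome; every root of unity is a
component of an element of the cyclotome (compatible root systems exist in the divisible group of
units of an algebraically closed field), so `β` fixes `μ_∞`; then `β = id` by the rigidity lemma
`MLFClosure.submonoid_equivariant_eq_self` (torus Kummer-faithfulness of the finite levels `k(x)`,
`KummerFaithfulLocalFieldProofs.lean`).  The second conjunct (existence of lifts: the LCFT
reconstruction of `k̄^×` from `G_k`, [AbsAnab] Prop. 1.2.1) is NOT addressed here.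

HONEST FRAMING: OUR kernel check of (half of) a statement of a refereed paper; nothing here bears on
[IUTchIII] Cor. 3.12.
-/

noncomputable section

namespace Literature.AnabelianGeometry.AbsoluteAnabelian

open Literature.AnabelianGeometry.EtaleTheta
open _root_.ValuativeRel

/-! ### Transport lemmas for isomorphisms of pairs -/

namespace GaloisMonoidPair.Iso

variable {P Q : GaloisMonoidPair.{0}}

/-- The inverse of an isomorphism of pairs is compatible with the actions.
[cite: MochizukiAbsTopIII2015, Definition 3.1 (ii) p.67] -/
theorem symm_smul_comm (e : GaloisMonoidPair.Iso P Q) (h : Q.Pi) (y : Q.M) :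
    e.isoM.symm (h • y) = e.isoPi.symm h • e.isoM.symm y := by
  apply e.isoM.injective
  rw [MulEquiv.apply_symm_apply, e.smul_comm, ContinuousMulEquiv.apply_symm_apply,
    MulEquiv.apply_symm_apply]

end GaloisMonoidPair.Iso

/-! ### The abstract core: a model-like pair `(Π ↷ M)` with `M ↪ k̄` -/

/-- **Core of Prop 3.3 (ii), determination.**  Let `(k, k̄)` be the model data, `Q₀ = (Π ↷ M)` a
pair whose object embeds multiplicatively into `k̄` (`j`, injective, values non-zero, image
containing `μ_∞`, `M` closed under roots and a group), with `Π` acting through a surjection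
`aug : Π ↠ Gal(k̄/k)`.  Then two isomorphisms `e₁, e₂ : P ⥲ Q` of pairs isomorphic to `Q₀`
(`ι : Q₀ ⥲ P`) with the same Galois component and the same induced map on the cyclotomes
`μ_Ẑ(P.M) → μ_Ẑ(Q.M)` have the same object component.
[cite: MochizukiAbsTopIII2015, Proposition 3.3 (ii) p.74] -/
theorem GaloisMonoidPair.Iso.isoM_eq_of_embedding (C : MLFClosure.{0})
    {Q₀ P Q : GaloisMonoidPair.{0}}
    (aug : Q₀.Pi →* (C.K ≃ₐ[C.k] C.K)) (haug : Function.Surjective aug)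
    (j : Q₀.M →* C.K) (hj : Function.Injective j)
    (hsmul : ∀ (g : Q₀.Pi) (m : Q₀.M), j (g • m) = aug g (j m))
    (hroot : ∀ (m : Q₀.M) (n : ℕ), 0 < n → ∃ r : Q₀.M, r ^ n = m)
    (hμ : ∀ (ζ : C.K) (n : ℕ), 0 < n → ζ ^ n = 1 → ∃ m : Q₀.M, j m = ζ)
    (h0 : ∀ m : Q₀.M, j m ≠ 0) (hunit : ∀ m : Q₀.M, IsUnit m)
    (ι : GaloisMonoidPair.Iso Q₀ P) (e₁ e₂ : GaloisMonoidPair.Iso P Q) (hPi : e₁.isoPi = e₂.isoPi)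
    (hcyc : ∀ ζ : cyclotome P.M,
      cyclotome.map (Units.map e₁.isoM.toMonoidHom) ζ = cyclotome.map (Units.map e₂.isoM.toMonoidHom) ζ) :
    e₁.isoM = e₂.isoM := by
  classical
  -- (0) the equivariant automorphism `β₀` of `Q₀.M` over the identity of `Π`
  set β₀ : Q₀.M ≃* Q₀.M := ι.isoM.trans (e₁.isoM.trans (e₂.isoM.symm.trans ι.isoM.symm)) with hβ₀
  have hβ₀_apply : ∀ m, β₀ m = ι.isoM.symm (e₂.isoM.symm (e₁.isoM (ι.isoM m))) := fun m => rfl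
  have hβ₀_smul : ∀ (g : Q₀.Pi) (m : Q₀.M), β₀ (g • m) = g • β₀ m := by
    intro g m
    rw [hβ₀_apply, hβ₀_apply, ι.smul_comm, e₁.smul_comm, GaloisMonoidPair.Iso.symm_smul_comm,
      GaloisMonoidPair.Iso.symm_smul_comm, hPi, ContinuousMulEquiv.symm_apply_apply,
      ContinuousMulEquiv.symm_apply_apply]
  -- the image submonoid `S = j(M) ⊆ k̄` and the transport `θ : M ≃* S`
  set S : Submonoid C.K := MonoidHom.mrange j with hS
  have hjr_inj : Function.Injective j.mrangeRestrict := fun a b h =>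
    hj (by simpa using congrArg Subtype.val h)
  set θ : Q₀.M ≃* S := MulEquiv.ofBijective j.mrangeRestrict
    ⟨hjr_inj, MonoidHom.mrangeRestrict_surjective j⟩ with hθ
  have hθ_val : ∀ m : Q₀.M, ((θ m : S) : C.K) = j m := fun m => rfl
  have hθ_symm_val : ∀ x : S, j (θ.symm x) = (x : C.K) := by
    intro x
    have := hθ_val (θ.symm x)
    rw [MulEquiv.apply_symm_apply] at this
    exact this.symm
  set β : S →* S := (θ.symm.trans (β₀.trans θ)).toMonoidHom with hβ
  have hβ_apply : ∀ x : S, β x = θ (β₀ (θ.symm x)) := fun x => rfl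
  -- hypotheses of the rigidity lemma
  have hM : ∀ (σ : C.K ≃ₐ[C.k] C.K) (x : C.K), x ∈ S → σ x ∈ S := by
    rintro σ _ ⟨m, rfl⟩
    obtain ⟨g, rfl⟩ := haug σ
    exact ⟨g • m, hsmul g m⟩
  have hrootS : ∀ x ∈ S, ∀ n : ℕ, 0 < n → ∃ y ∈ S, y ^ n = x := by
    rintro _ ⟨m, rfl⟩ n hn
    obtain ⟨r, hr⟩ := hroot m n hn
    exact ⟨j r, ⟨r, rfl⟩, by rw [← map_pow, hr]⟩
  have hμS : ∀ (ζ : C.K) (n : ℕ), 0 < n → ζ ^ n = 1 → ζ ∈ S := by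
    intro ζ n hn hζ
    obtain ⟨m, hm⟩ := hμ ζ n hn hζ
    exact ⟨m, hm⟩
  have h0S : (0 : C.K) ∉ S := by
    rintro ⟨m, hm⟩
    exact h0 m hm
  have hβσ : ∀ (σ : C.K ≃ₐ[C.k] C.K) (x : S), (β ⟨σ x, hM σ x x.2⟩ : C.K) = σ (β x) := by
    intro σ x
    obtain ⟨g, rfl⟩ := haug σ
    set m := θ.symm x with hm
    have hx : x = θ m := by rw [hm, MulEquiv.apply_symm_apply]
    have hgx : (⟨aug g x, hM (aug g) x x.2⟩ : S) = θ (g • m) := by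
      apply Subtype.ext
      show aug g (x : C.K) = ((θ (g • m) : S) : C.K)
      rw [hθ_val, hsmul, hx, hθ_val]
    rw [hgx, hβ_apply, hβ_apply, MulEquiv.symm_apply_apply, hβ₀_smul, hθ_val, hsmul, hx,
      MulEquiv.symm_apply_apply, hθ_val]
  have hβμ : ∀ (x : S) (n : ℕ), 0 < n → (x : C.K) ^ n = 1 → β x = x := by
    intro x n hn hxn
    set m := θ.symm x with hm
    have hx : x = θ m := by rw [hm, MulEquiv.apply_symm_apply]
    -- `m ^ n = 1` in `Q₀.M`
    have hmn : m ^ n = 1 := by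
      apply hj
      rw [map_pow, map_one, hm, hθ_symm_val]
      exact hxn
    -- a compatible root system of the unit `u = m` in `(Q₀.M)ˣ`
    letI : RootableBy (Q₀.M)ˣ ℕ := rootableByOfPowLeftSurj (Q₀.M)ˣ ℕ (by
      intro k hk v
      obtain ⟨r, hr⟩ := hroot (v : Q₀.M) k (Nat.pos_of_ne_zero hk)
      refine ⟨(hunit r).unit, Units.ext ?_⟩
      simp [Units.val_pow_eq_pow_val, hr])
    set u : (Q₀.M)ˣ := (hunit m).unit with hu
    have hu_val : (u : Q₀.M) = m := (hunit m).unit_spec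
    have hun : u ^ n = 1 := Units.ext (by rw [Units.val_pow_eq_pow_val, hu_val, hmn, Units.val_one])
    set s : RootSystem u := RootSystem.ofRootableBy u with hs
    set nP : ℕ+ := ⟨n, hn⟩ with hnP
    -- the cyclotome element `c i := (s.root i) ^ n`, with `c n = u`
    have hc : (fun i : ℕ+ => s.root i ^ n) ∈ cyclotome Q₀.M := by
      show (fun i : ℕ+ => s.root i ^ n) ∈ EtaleTheta.cyclotome (Q₀.M)ˣ
      rw [EtaleTheta.cyclotome.mem_iff]
      refine ⟨fun i => ?_, fun i i' => ?_⟩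
      · rw [← pow_mul, mul_comm, pow_mul, s.pow_self, hun]
      · rw [← pow_mul, mul_comm n (i' : ℕ), pow_mul, s.root_mul_pow]
    have hcn : (fun i : ℕ+ => s.root i ^ n) nP = u := by
      simp only [hnP]
      exact s.pow_self ⟨n, hn⟩
    -- transport to `P` and evaluate the cyclotome hypothesis at the index `n`
    set ζ : cyclotome P.M := cyclotome.map (Units.map ι.isoM.toMonoidHom) ⟨_, hc⟩ with hζ
    have key := congrArg (fun ξ : cyclotome Q.M => (((ξ : ℕ+ → (Q.M)ˣ) nP : (Q.M)ˣ) : Q.M)) (hcyc ζ)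
    simp only [hζ, EtaleTheta.cyclotome.map_apply, Units.coe_map, MulEquiv.coe_toMonoidHom, hcn, hu_val] at key
    -- key : e₁.isoM (ι.isoM m) = e₂.isoM (ι.isoM m)
    have hβ₀m : β₀ m = m := by
      rw [hβ₀_apply, key, MulEquiv.symm_apply_apply, MulEquiv.symm_apply_apply]
    rw [hβ_apply, ← hm, hβ₀m, ← hx]
  -- rigidity: `β = id`, hence `β₀ = id`, hence `e₁.isoM = e₂.isoM`
  have hβid := MLFClosure.submonoid_equivariant_eq_self C S hM hrootS hμS h0S β hβσ hβμ
  have hβ₀id : ∀ m : Q₀.M, β₀ m = m := by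
    intro m
    have := hβid (θ m)
    rw [hβ_apply, MulEquiv.symm_apply_apply] at this
    exact θ.injective this
  apply MulEquiv.ext
  intro p
  have h1 := hβ₀id (ι.isoM.symm p)
  rw [hβ₀_apply, MulEquiv.apply_symm_apply] at h1
  have h2 := congrArg ι.isoM h1
  rw [MulEquiv.apply_symm_apply, MulEquiv.apply_symm_apply] at h2
  -- h2 : e₂.isoM.symm (e₁.isoM p) = p
  have h3 := congrArg e₂.isoM h2
  rw [MulEquiv.apply_symm_apply] at h3
  exact h3

/-! ### The two model cases `TLG` (`M = k̄^×`) and `TCG` (`M = 𝒪_k̄^×`) -/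

section Models

variable (C : MLFClosure.{0})

/-- In the model `TLG`-object `k̄^×` (`nonZeroDivisors k̄`) every element has `n`-th roots (`k̄` is
algebraically closed). [cite: MochizukiAbsTopIII2015, Definition 3.1 (i) p.66] -/
theorem MLFClosure.nonZeroDivisors_exists_pow_eq (m : nonZeroDivisors C.K) (n : ℕ) (hn : 0 < n) :
    ∃ r : nonZeroDivisors C.K, r ^ n = m := by
  haveI : IsAlgClosed C.K := IsAlgClosure.isAlgClosed C.k
  obtain ⟨y, hy⟩ := IsAlgClosed.exists_pow_nat_eq (m : C.K) hn
  have hy0 : y ≠ 0 := by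
    intro h
    rw [h, zero_pow hn.ne'] at hy
    exact nonZeroDivisors.coe_ne_zero m hy.symm
  exact ⟨⟨y, mem_nonZeroDivisors_of_ne_zero hy0⟩, Subtype.ext (by simpa using hy)⟩

/-- In the model `TCG`-object `𝒪_k̄^×` (`unitSubmonoid`) every element has `n`-th roots (an `n`-th
root of a unit of `𝒪_k̄` is again a unit of `𝒪_k̄`). [cite: MochizukiAbsTopIII2015, Definition 3.1 (i) p.66] -/
theorem MLFClosure.unitSubmonoid_exists_pow_eq (m : unitSubmonoid C.k C.K) (n : ℕ) (hn : 0 < n) :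
    ∃ r : unitSubmonoid C.k C.K, r ^ n = m := by
  haveI : IsAlgClosed C.K := IsAlgClosure.isAlgClosed C.k
  obtain ⟨hx, y, hy, hxy⟩ := m.2
  have hx0 : (m : C.K) ≠ 0 := left_ne_zero_of_mul_eq_one hxy
  obtain ⟨r, hr⟩ := IsAlgClosed.exists_pow_nat_eq (m : C.K) hn
  have hr0 : r ≠ 0 := by
    intro h
    rw [h, zero_pow hn.ne'] at hr
    exact hx0 hr.symm
  have hyinv : y = (m : C.K)⁻¹ := eq_inv_of_mul_eq_one_right hxy
  have hrint : r ∈ integersClosure C.k C.K := by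
    rw [integersClosure, mem_integralClosure_iff]
    refine IsIntegral.of_pow hn ?_
    rw [hr]
    exact (mem_integralClosure_iff _ _).mp hx
  have hrinv : r⁻¹ ∈ integersClosure C.k C.K := by
    rw [integersClosure, mem_integralClosure_iff]
    refine IsIntegral.of_pow hn ?_
    rw [inv_pow, hr, ← hyinv]
    exact (mem_integralClosure_iff _ _).mp hy
  refine ⟨⟨r, hrint, r⁻¹, hrinv, mul_inv_cancel₀ hr0⟩, Subtype.ext (by simpa using hr)⟩

/-- Roots of unity lie in `𝒪_k̄^×`. [cite: MochizukiAbsTopIII2015, Definition 3.1 (i) p.66] -/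
theorem MLFClosure.mem_unitSubmonoid_of_pow_eq_one (ζ : C.K) (n : ℕ) (hn : 0 < n) (hζ : ζ ^ n = 1) :
    ζ ∈ unitSubmonoid C.k C.K := by
  have hζint : IsIntegral 𝒪[C.k] ζ := IsIntegral.of_pow hn (by rw [hζ]; exact isIntegral_one)
  refine ⟨(mem_integralClosure_iff _ _).mpr hζint, ζ ^ (n - 1),
    (mem_integralClosure_iff _ _).mpr (hζint.pow _), ?_⟩
  rw [← pow_succ', Nat.sub_add_cancel hn, hζ]

/-- Elements of the model `TCG`-object are units of that monoid. [cite: MochizukiAbsTopIII2015, Definition 3.1 (i) p.66] -/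
theorem MLFClosure.isUnit_unitSubmonoid (m : unitSubmonoid C.k C.K) : IsUnit m := by
  obtain ⟨hx, y, hy, hxy⟩ := m.2
  refine isUnit_iff_exists_inv.mpr ⟨⟨y, hy, (m : C.K), hx, by rw [mul_comm]; exact hxy⟩, ?_⟩
  exact Subtype.ext hxy

/-- Elements of the model `TLG`-object are units of that monoid. [cite: MochizukiAbsTopIII2015, Definition 3.1 (i) p.66] -/
theorem MLFClosure.isUnit_nonZeroDivisors (m : nonZeroDivisors C.K) : IsUnit m := by
  have h0 : (m : C.K) ≠ 0 := nonZeroDivisors.coe_ne_zero m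
  refine isUnit_iff_exists_inv.mpr ⟨⟨(m : C.K)⁻¹, mem_nonZeroDivisors_of_ne_zero (inv_ne_zero h0)⟩, ?_⟩
  exact Subtype.ext (mul_inv_cancel₀ h0)

end Models

/-! ### Prop 3.3 (ii), determination half -/

/-- **[AbsTopIII] Prop 3.3 (ii), determination half — the first conjunct of `UnitPairIsoFibres`,
PROVED**: for `T ∈ {TLG, TCG}` and MLF-Galois `T`-pairs `(Π ↷ M)`, `(Π* ↷ M*)`, two isomorphisms of
pairs with the same Galois component `Π ⥲ Π*` and the same induced map on the cyclotomes
`μ_Ẑ(M) → μ_Ẑ(M*)` coincide ("an isomorphism `(Π ↷ M) ⥲ (Π* ↷ M*)` induces `Π ⥲ Π*`,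
`μ_Ẑ(M) ⥲ μ_Ẑ(M*)`, which determine an injection
`Isom((Π ↷ M),(Π* ↷ M*)) ↪ Isom(Π,Π*) × Isom(μ_Ẑ(M), μ_Ẑ(M*))`", p. 74).  (Only the hypothesis on
`P` is used; the one on `Q` is part of the typed statement.)
[cite: MochizukiAbsTopIII2015, Proposition 3.3 (ii) p.74] -/
theorem unitPairIso_isoM_eq :
    ∀ (T : PairType) (P Q : GaloisMonoidPair.{0}), (T = .TLG ∨ T = .TCG) →
      IsMLFGaloisMonoidPair T P → IsMLFGaloisMonoidPair T Q →
      ∀ e₁ e₂ : GaloisMonoidPair.Iso P Q, e₁.isoPi = e₂.isoPi →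
        (∀ ζ : cyclotome P.M,
          Literature.AnabelianGeometry.EtaleTheta.cyclotome.map (Units.map e₁.isoM.toMonoidHom) ζ =
          Literature.AnabelianGeometry.EtaleTheta.cyclotome.map (Units.map e₂.isoM.toMonoidHom) ζ) →
        e₁.isoM = e₂.isoM := by
  intro T P Q hT hP _hQ e₁ e₂ hPi hcyc
  obtain ⟨C, D, Q₀, hQ₀, ⟨ι⟩⟩ := hP.exists_model
  rcases hT with rfl | rfl
  · -- `T = TLG`: the model object is `k̄^× = nonZeroDivisors k̄`
    simp only [ModelMLFGaloisData.monoidPair, Option.some.injEq] at hQ₀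
    subst hQ₀
    refine GaloisMonoidPair.Iso.isoM_eq_of_embedding C D.aug D.aug_surjective
      (nonZeroDivisors C.K).subtype Subtype.val_injective (fun g m => rfl)
      (MLFClosure.nonZeroDivisors_exists_pow_eq C) ?_ (fun m => nonZeroDivisors.coe_ne_zero m)
      (MLFClosure.isUnit_nonZeroDivisors C) ι e₁ e₂ hPi hcyc
    intro ζ n hn hζ
    have hζ0 : ζ ≠ 0 := by
      intro h
      rw [h, zero_pow hn.ne'] at hζ
      exact zero_ne_one hζ
    exact ⟨⟨ζ, mem_nonZeroDivisors_of_ne_zero hζ0⟩, rfl⟩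
  · -- `T = TCG`: the model object is `𝒪_k̄^× = unitSubmonoid`
    simp only [ModelMLFGaloisData.monoidPair, Option.some.injEq] at hQ₀
    subst hQ₀
    refine GaloisMonoidPair.Iso.isoM_eq_of_embedding C D.aug D.aug_surjective
      (unitSubmonoid C.k C.K).subtype Subtype.val_injective (fun g m => rfl)
      (MLFClosure.unitSubmonoid_exists_pow_eq C) ?_ ?_ (MLFClosure.isUnit_unitSubmonoid C)
      ι e₁ e₂ hPi hcyc
    · intro ζ n hn hζ
      exact ⟨⟨ζ, MLFClosure.mem_unitSubmonoid_of_pow_eq_one C ζ n hn hζ⟩, rfl⟩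
    · intro m
      obtain ⟨-, y, -, hxy⟩ := m.2
      exact left_ne_zero_of_mul_eq_one hxy

/-- `UnitPairIsoFibres` is the conjunction of the determination half (PROVED above) and the
surjectivity / fibre-cardinality half for `TLG` (which needs the reconstruction of `k̄^×` from `G_k`
by local class field theory, [AbsAnab] Prop. 1.2.1 — NOT proved here): the named fact REDUCES to its
second conjunct. [cite: MochizukiAbsTopIII2015, Proposition 3.3 (ii) p.74] -/
theorem unitPairIsoFibres_iff_surjectivity_half :
    UnitPairIsoFibres ↔
      (∀ (P Q : GaloisMonoidPair.{0}), IsMLFGaloisMonoidPair .TLG P → IsMLFGaloisMonoidPair .TLG Q →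
        ∀ f : P.Pi ≃ₜ* Q.Pi, P.actionKer.map f.toMulEquiv.toMonoidHom = Q.actionKer →
          ∃ e₁ e₂ : GaloisMonoidPair.Iso P Q, e₁.isoPi = f ∧ e₂.isoPi = f ∧
          e₁.isoM ≠ e₂.isoM ∧ ∀ e : GaloisMonoidPair.Iso P Q, e.isoPi = f → (e.isoM = e₁.isoM ∨ e.isoM = e₂.isoM)) :=
  ⟨fun h => h.2, fun h => ⟨unitPairIso_isoM_eq, h⟩⟩

end Literature.AnabelianGeometry.AbsoluteAnabelian

end
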